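import Mathlib
import Literature.Geometry.DiscreteGeometry.ShellCensusTwelve

/-!
# Crux `GappedShellCensus.FiveFoldRationingR` (stmt-AtomisticToContinuum-18071), line `Sketch` —
# stub `stub_ffrLinkGlue` (from the two tuple censuses to the link types)

Let `Y ⊆ ℝ³` be all-gapped-twelve at scale `a` (every `y ∈ Y` has exactly twelve other points of `Y`
within `a (1 + 1/50)`, none closer than `a (1 − 1/50)`, none in `(a (1 + 1/50), a · 63/50)`),
torn-free (every bond has `≥ 4` common bonded partners) and with F1 (every bond has `≤ 5` common
bonded partners).  Fix `y ∈ Y` and enumerate its shell injectively, `w : Fin 12 → ℝ³`; the rescaled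
tuple `t k := a⁻¹ • (w k − y)` has norms in `[1 − 1/50, 1 + 1/50]`, pairwise distances `≥ 1 − 1/50`
and each pair bonded (`≤ 1 + 1/50`) or far (`≥ 63/50`), by the gap hypothesis at `y` and at `w k`.
The shell-degree of `k` in `t` is the number of common bonded partners of the bond `(y, w k)`, hence
in `[4, 5]`.  If all degrees are `4`, the degree-four census gives the cuboctahedral or
anticuboctahedral bond graph in `sqNormInt (fccVec k − fccVec l) = 2` / `sqNormInt (hcpVec k − hcpVec l)
= 18` form, which a decidable dictionary turns into the explicit edge lists; otherwise some degree is
`5` and the capped census gives the bicapped-pentagonal-prism edge list directly.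
-/

noncomputable section

namespace Summit.AtomisticToContinuum.Crystallization.Theorems

/-- Dictionary: the cuboctahedral bond relation `|fccVec i − fccVec j|² = 2`, for `i < j`, is the
explicit fcc edge list. [folklore] -/
theorem ffrLG_fcc_dict : ∀ i j : Fin 12, i < j →
    (Literature.Geometry.DiscreteGeometry.sqNormInt
        (Literature.Geometry.DiscreteGeometry.ShellCensus.fccVec i -
          Literature.Geometry.DiscreteGeometry.ShellCensus.fccVec j) = 2 ↔
      (i.val, j.val) ∈ ([(0, 4), (0, 5), (0, 8), (0, 9), (1, 4), (1, 5), (1, 10), (1, 11), (2, 6), (2, 7),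
          (2, 8), (2, 9), (3, 6), (3, 7), (3, 10), (3, 11), (4, 8), (4, 10), (5, 9), (5, 11),
          (6, 8), (6, 10), (7, 9), (7, 11)] : List (ℕ × ℕ))) := by
  decide

/-- Dictionary: the anticuboctahedral bond relation `|hcpVec i − hcpVec j|² = 18`, for `i < j`, is the
explicit hcp edge list. [folklore] -/
theorem ffrLG_hcp_dict : ∀ i j : Fin 12, i < j →
    (Literature.Geometry.DiscreteGeometry.sqNormInt
        (Literature.Geometry.DiscreteGeometry.ShellCensus.hcpVec i -
          Literature.Geometry.DiscreteGeometry.ShellCensus.hcpVec j) = 18 ↔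
      (i.val, j.val) ∈ ([(0, 2), (0, 5), (0, 7), (0, 10), (1, 3), (1, 4), (1, 8), (1, 11), (2, 4), (2, 6),
          (2, 9), (3, 5), (3, 8), (3, 11), (4, 6), (4, 9), (5, 7), (5, 10), (6, 7), (6, 8),
          (7, 8), (9, 10), (9, 11), (10, 11)] : List (ℕ × ℕ))) := by
  decide

/-- A set of twelve points of `ℝ³` is the range of an injective twelve-tuple. [folklore] -/
theorem ffrLG_tuple {S : Set (EuclideanSpace ℝ (Fin 3))} (hS : S.ncard = 12) :
    ∃ w : Fin 12 → EuclideanSpace ℝ (Fin 3), Function.Injective w ∧ Set.range w = S := by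
  have hfin : S.Finite := Set.finite_of_ncard_ne_zero (by rw [hS]; norm_num)
  have hcard : hfin.toFinset.card = 12 := by
    rw [← Set.ncard_eq_toFinset_card S hfin]
    exact hS
  obtain ⟨w, hw, himg⟩ :=
    Literature.Geometry.DiscreteGeometry.ShellCensus.exists_tuple_of_card _ hcard
  refine ⟨w, hw, ?_⟩
  rw [← Set.image_univ, ← Finset.coe_univ, ← Finset.coe_image, himg, Set.Finite.coe_toFinset]

/-- **Rescaling the shell.** If `w` enumerates injectively the shell of `y ∈ Y` (points of `Y` other
than `y` within `a (1 + 1/50)`) in a gapped configuration, then `t k := a⁻¹ • (w k − y)` is an injective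
tuple with norms in `[1 − 1/50, 1 + 1/50]`, pairwise distances `≥ 1 − 1/50`, each pair bonded or far, and
`t k, t l` are bonded iff `w k, w l` are. [folklore] -/
theorem ffrLG_rescale {Y : Set (EuclideanSpace ℝ (Fin 3))} {a : ℝ} (ha : 0 < a)
    (hwin : ∀ y ∈ Y, ∀ w ∈ Y, w ≠ y → a * (1 - 1 / 50) ≤ dist y w ∧
      (dist y w ≤ a * (1 + 1 / 50) ∨ a * (63 / 50) ≤ dist y w))
    {y : EuclideanSpace ℝ (Fin 3)} (hy : y ∈ Y) {w : Fin 12 → EuclideanSpace ℝ (Fin 3)}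
    (hw : Function.Injective w)
    (hrange : Set.range w = {u ∈ Y | u ≠ y ∧ dist y u ≤ a * (1 + 1 / 50)}) :
    ∃ t : Fin 12 → EuclideanSpace ℝ (Fin 3), Function.Injective t ∧
      (∀ k, 1 - 1 / 50 ≤ ‖t k‖ ∧ ‖t k‖ ≤ 1 + 1 / 50) ∧
      (∀ k l, k ≠ l → 1 - 1 / 50 ≤ dist (t k) (t l) ∧
        (dist (t k) (t l) ≤ 1 + 1 / 50 ∨ 63 / 50 ≤ dist (t k) (t l))) ∧
      (∀ k l, (dist (t k) (t l) ≤ 1 + 1 / 50 ↔ dist (w k) (w l) ≤ a * (1 + 1 / 50))) := by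
  have hmem : ∀ k, w k ∈ Y ∧ w k ≠ y ∧ dist y (w k) ≤ a * (1 + 1 / 50) := by
    intro k
    have hk : w k ∈ Set.range w := ⟨k, rfl⟩
    rw [hrange] at hk
    exact hk
  have hnorm : ∀ k, ‖a⁻¹ • (w k - y)‖ = dist y (w k) / a := by
    intro k
    rw [norm_smul, norm_inv, Real.norm_of_nonneg ha.le, ← dist_eq_norm, dist_comm, div_eq_inv_mul]
  have hdist : ∀ k l, dist (a⁻¹ • (w k - y)) (a⁻¹ • (w l - y)) = dist (w k) (w l) / a := by
    intro k l
    rw [dist_smul₀, norm_inv, Real.norm_of_nonneg ha.le, dist_sub_right, div_eq_inv_mul]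
  refine ⟨fun k => a⁻¹ • (w k - y), ?_, ?_, ?_, ?_⟩
  · intro k l hkl
    have h1 : a • a⁻¹ • (w k - y) = a • a⁻¹ • (w l - y) := congrArg (fun v => a • v) hkl
    rw [smul_inv_smul₀ ha.ne', smul_inv_smul₀ ha.ne', sub_left_inj] at h1
    exact hw h1
  · intro k
    dsimp only
    rw [hnorm k, le_div_iff₀ ha, div_le_iff₀ ha]
    obtain ⟨hkY, hky, hyk⟩ := hmem k
    have hlo := (hwin y hy (w k) hkY hky).1
    constructor <;> linarith
  · intro k l hkl
    dsimp only
    rw [hdist k l, le_div_iff₀ ha, div_le_iff₀ ha, le_div_iff₀ ha]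
    have hne : w l ≠ w k := fun h => hkl (hw h).symm
    obtain ⟨hlo, hwin'⟩ := hwin (w k) (hmem k).1 (w l) (hmem l).1 hne
    refine ⟨by linarith, ?_⟩
    rcases hwin' with h | h
    · left
      linarith
    · right
      linarith
  · intro k l
    dsimp only
    rw [hdist k l, div_le_iff₀ ha, mul_comm]

/-- **Degree dictionary.** With `w`, `t` as in `ffrLG_rescale`, the shell-degree of `k` in `t` is the
number of common bonded partners of the bond `(y, w k)`. [folklore] -/
theorem ffrLG_degree {Y : Set (EuclideanSpace ℝ (Fin 3))} {y : EuclideanSpace ℝ (Fin 3)} {R : ℝ}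
    {w t : Fin 12 → EuclideanSpace ℝ (Fin 3)} (hw : Function.Injective w)
    (hrange : Set.range w = {u ∈ Y | u ≠ y ∧ dist y u ≤ R})
    (hiff : ∀ k l, (dist (t k) (t l) ≤ 1 + 1 / 50 ↔ dist (w k) (w l) ≤ R)) (k : Fin 12) :
    (Finset.univ.filter fun l => l ≠ k ∧ dist (t k) (t l) ≤ 1 + 1 / 50).card =
      {u ∈ Y | u ≠ y ∧ u ≠ w k ∧ dist y u ≤ R ∧ dist (w k) u ≤ R}.ncard := by
  have hC : {u ∈ Y | u ≠ y ∧ u ≠ w k ∧ dist y u ≤ R ∧ dist (w k) u ≤ R} =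
      w '' ↑(Finset.univ.filter fun l => l ≠ k ∧ dist (t k) (t l) ≤ 1 + 1 / 50) := by
    ext u
    simp only [Set.mem_setOf_eq, Set.mem_image, Finset.mem_coe, Finset.mem_filter, Finset.mem_univ,
      true_and]
    constructor
    · rintro ⟨huY, huy, huk, hyu, hku⟩
      have huS : u ∈ Set.range w := by
        rw [hrange]
        exact ⟨huY, huy, hyu⟩
      obtain ⟨l, rfl⟩ := huS
      exact ⟨l, ⟨fun h => huk (by rw [h]), (hiff k l).mpr hku⟩, rfl⟩
    · rintro ⟨l, ⟨hlk, hl⟩, rfl⟩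
      have hlS : w l ∈ {u ∈ Y | u ≠ y ∧ dist y u ≤ R} := by
        rw [← hrange]
        exact ⟨l, rfl⟩
      obtain ⟨hlY, hly, hyl⟩ := hlS
      exact ⟨hlY, hly, fun h => hlk (hw h), hyl, (hiff k l).mp hl⟩
  rw [hC, Set.ncard_image_of_injective _ hw, Set.ncard_coe_finset]

/-- **Stub L-glue (provable now).** From the two tuple censuses to the link types of an all-gapped-twelve
torn-free configuration with F1: the shell of `y` is a rescaled injective twelve-tuple whose shell-degrees
are the common-partner counts of the bonds at `y`, hence in `[4, 5]`; the fcc/hcp graphs in `sqNormInt`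
form are the explicit edge lists in the order of `fccVec` / `hcpVec`. [folklore] -/
theorem stub_ffrLinkGlue :
    ∀ (Y : Set (EuclideanSpace ℝ (Fin 3))) (a : ℝ), 0 < a →
      (∀ y ∈ Y, ({w ∈ Y | w ≠ y ∧ dist y w ≤ a * (1 + 1 / 50)}.ncard = 12 ∧
        ∀ w ∈ Y, w ≠ y → a * (1 - 1 / 50) ≤ dist y w ∧
          (dist y w ≤ a * (1 + 1 / 50) ∨ a * (63 / 50) ≤ dist y w))) →
      (∀ y ∈ Y, ∀ v ∈ Y, v ≠ y → dist y v ≤ a * (1 + 1 / 50) →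
        4 ≤ {w ∈ Y | w ≠ y ∧ w ≠ v ∧ dist y w ≤ a * (1 + 1 / 50) ∧ dist v w ≤ a * (1 + 1 / 50)}.ncard) →
      (∀ y ∈ Y, ∀ v ∈ Y, v ≠ y → dist y v ≤ a * (1 + 1 / 50) →
        {w ∈ Y | w ≠ y ∧ w ≠ v ∧ dist y w ≤ a * (1 + 1 / 50) ∧ dist v w ≤ a * (1 + 1 / 50)}.ncard ≤ 5) →
      (∀ t : Fin 12 → EuclideanSpace ℝ (Fin 3), Function.Injective t →
        (∀ k, 1 - 1 / 50 ≤ ‖t k‖ ∧ ‖t k‖ ≤ 1 + 1 / 50) →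
        (∀ k l, k ≠ l → 1 - 1 / 50 ≤ dist (t k) (t l) ∧ (dist (t k) (t l) ≤ 1 + 1 / 50 ∨ 63 / 50 ≤ dist (t k) (t l))) →
        (∀ k, (Finset.univ.filter fun l => l ≠ k ∧ dist (t k) (t l) ≤ 1 + 1 / 50).card = 4) →
        ∃ σ : Equiv.Perm (Fin 12),
          (∀ k l, k ≠ l → (dist (t (σ k)) (t (σ l)) ≤ 1 + 1 / 50 ↔
            Literature.Geometry.DiscreteGeometry.sqNormInt
              (Literature.Geometry.DiscreteGeometry.ShellCensus.fccVec k -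
                Literature.Geometry.DiscreteGeometry.ShellCensus.fccVec l) = 2)) ∨
          (∀ k l, k ≠ l → (dist (t (σ k)) (t (σ l)) ≤ 1 + 1 / 50 ↔
            Literature.Geometry.DiscreteGeometry.sqNormInt
              (Literature.Geometry.DiscreteGeometry.ShellCensus.hcpVec k -
                Literature.Geometry.DiscreteGeometry.ShellCensus.hcpVec l) = 18))) →
      (∀ t : Fin 12 → EuclideanSpace ℝ (Fin 3), Function.Injective t →
        (∀ k, 1 - 1 / 50 ≤ ‖t k‖ ∧ ‖t k‖ ≤ 1 + 1 / 50) →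
        (∀ k l, k ≠ l → 1 - 1 / 50 ≤ dist (t k) (t l) ∧ (dist (t k) (t l) ≤ 1 + 1 / 50 ∨ 63 / 50 ≤ dist (t k) (t l))) →
        (∀ k, 4 ≤ (Finset.univ.filter fun l => l ≠ k ∧ dist (t k) (t l) ≤ 1 + 1 / 50).card) →
        (∀ k, (Finset.univ.filter fun l => l ≠ k ∧ dist (t k) (t l) ≤ 1 + 1 / 50).card ≤ 5) →
        (∃ k, 5 ≤ (Finset.univ.filter fun l => l ≠ k ∧ dist (t k) (t l) ≤ 1 + 1 / 50).card) →
        ∃ σ : Equiv.Perm (Fin 12), ∀ k l : Fin 12, k < l →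
          (dist (t (σ k)) (t (σ l)) ≤ 1 + 1 / 50 ↔ (k.val, l.val) ∈ ([(0, 1), (0, 2), (0, 3), (0, 4), (0, 5), (1, 2), (1, 5), (1, 6), (2, 3), (2, 7), (3, 4),
                (3, 8), (4, 5), (4, 9), (5, 10), (6, 7), (6, 10), (6, 11), (7, 8), (7, 11), (8, 9),
                (8, 11), (9, 10), (9, 11), (10, 11)] : List (ℕ × ℕ)))) →
      (∀ y ∈ Y, ∃ e : Fin 12 → EuclideanSpace ℝ (Fin 3), Function.Injective e ∧
        Set.range e = {w ∈ Y | w ≠ y ∧ dist y w ≤ a * (1 + 1 / 50)} ∧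
        ((∀ i j : Fin 12, i < j → (dist (e i) (e j) ≤ a * (1 + 1 / 50) ↔
            (i.val, j.val) ∈ ([(0, 4), (0, 5), (0, 8), (0, 9), (1, 4), (1, 5), (1, 10), (1, 11), (2, 6), (2, 7),
                (2, 8), (2, 9), (3, 6), (3, 7), (3, 10), (3, 11), (4, 8), (4, 10), (5, 9), (5, 11),
                (6, 8), (6, 10), (7, 9), (7, 11)] : List (ℕ × ℕ)))) ∨
          (∀ i j : Fin 12, i < j → (dist (e i) (e j) ≤ a * (1 + 1 / 50) ↔
            (i.val, j.val) ∈ ([(0, 2), (0, 5), (0, 7), (0, 10), (1, 3), (1, 4), (1, 8), (1, 11), (2, 4), (2, 6),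
                (2, 9), (3, 5), (3, 8), (3, 11), (4, 6), (4, 9), (5, 7), (5, 10), (6, 7), (6, 8),
                (7, 8), (9, 10), (9, 11), (10, 11)] : List (ℕ × ℕ)))) ∨
          (∀ i j : Fin 12, i < j → (dist (e i) (e j) ≤ a * (1 + 1 / 50) ↔
            (i.val, j.val) ∈ ([(0, 1), (0, 2), (0, 3), (0, 4), (0, 5), (1, 2), (1, 5), (1, 6), (2, 3), (2, 7), (3, 4),
                (3, 8), (4, 5), (4, 9), (5, 10), (6, 7), (6, 10), (6, 11), (7, 8), (7, 11), (8, 9),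
                (8, 11), (9, 10), (9, 11), (10, 11)] : List (ℕ × ℕ)))))) := by
  intro Y a ha hgap htf hF1 C4 C5 y hy
  obtain ⟨w, hw, hrange⟩ := ffrLG_tuple (hgap y hy).1
  obtain ⟨t, ht, htn, htp, hiff⟩ :=
    ffrLG_rescale ha (fun y' hy' w' hw' hne => (hgap y' hy').2 w' hw' hne) hy hw hrange
  have hmem : ∀ k, w k ∈ Y ∧ w k ≠ y ∧ dist y (w k) ≤ a * (1 + 1 / 50) := by
    intro k
    have hk : w k ∈ Set.range w := ⟨k, rfl⟩
    rw [hrange] at hk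
    exact hk
  have hdeg := ffrLG_degree hw hrange hiff
  have h4 : ∀ k, 4 ≤ (Finset.univ.filter fun l => l ≠ k ∧ dist (t k) (t l) ≤ 1 + 1 / 50).card := by
    intro k
    rw [hdeg k]
    exact htf y hy (w k) (hmem k).1 (hmem k).2.1 (hmem k).2.2
  have h5 : ∀ k, (Finset.univ.filter fun l => l ≠ k ∧ dist (t k) (t l) ≤ 1 + 1 / 50).card ≤ 5 := by
    intro k
    rw [hdeg k]
    exact hF1 y hy (w k) (hmem k).1 (hmem k).2.1 (hmem k).2.2
  have hrange' : ∀ σ : Equiv.Perm (Fin 12),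
      Set.range (w ∘ σ) = {u ∈ Y | u ≠ y ∧ dist y u ≤ a * (1 + 1 / 50)} := by
    intro σ
    rw [σ.surjective.range_comp]
    exact hrange
  by_cases hall : ∀ k, (Finset.univ.filter fun l => l ≠ k ∧ dist (t k) (t l) ≤ 1 + 1 / 50).card = 4
  · -- all shell-degrees four: cuboctahedron or anticuboctahedron
    obtain ⟨σ, hσ⟩ := C4 t ht htn htp hall
    refine ⟨w ∘ σ, hw.comp σ.injective, hrange' σ, ?_⟩
    rcases hσ with h | h
    · left
      intro i j hij
      rw [Function.comp_apply, Function.comp_apply, ← hiff, h i j (ne_of_lt hij)]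
      exact ffrLG_fcc_dict i j hij
    · right
      left
      intro i j hij
      rw [Function.comp_apply, Function.comp_apply, ← hiff, h i j (ne_of_lt hij)]
      exact ffrLG_hcp_dict i j hij
  · -- some shell-degree five: bicapped pentagonal prism
    push Not at hall
    obtain ⟨k₀, hk₀⟩ := hall
    have h5k₀ : 5 ≤ (Finset.univ.filter fun l => l ≠ k₀ ∧ dist (t k₀) (t l) ≤ 1 + 1 / 50).card := by
      have h4' := h4 k₀
      have h5' := h5 k₀
      omega
    obtain ⟨σ, hσ⟩ := C5 t ht htn htp h4 h5 ⟨k₀, h5k₀⟩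
    refine ⟨w ∘ σ, hw.comp σ.injective, hrange' σ, ?_⟩
    right
    right
    intro i j hij
    rw [Function.comp_apply, Function.comp_apply, ← hiff]
    exact hσ i j hij

end Summit.AtomisticToContinuum.Crystallization.Theorems

end
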